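import Summits.Ventures.LatticeQCDFlow.Scaling.HubListsSharpLaw
import Summits.Ventures.LatticeQCDFlow.Scaling.UniversalPoincare
import Summits.Ventures.LatticeQCDFlow.Scaling.TreePoincare

/-!
HONEST FRAMING: exact (Metropolis-corrected) sampling algorithms for lattice gauge theory; figures
of merit are autocorrelation/cost numbers at stated couplings and volumes; no continuum-physics
claim.

# BroomSharpLaw — ONE INTERMEDIATE REPLICA BETWEEN THE HOT SEAT AND A STAR SQUARES THE TRANSPORT UNIT: FOR THE BROOM (`0 ~ 1`, `1 ~ k` for `k = 2, …, K`; `m = K`)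
# **`max{K²/t, (K+1)/h} ≤ 1/ρ ≤ max{4K²/t, 2(K+1)/h}`** — TWO-SIDED UP TO THE CONSTANT `4` — AND `((1−ρ)/ρ)·log((1−ν(u))·√(K/12)/4) ≤ t_mix(1/4) ≤ ⌈(1/ρ)·log(4h/ρ)⌉` (lean-2 GEN-48, ours)

Venture-side (OURS).  Cell `lqcd-flow` (pub-lqcd), unit `pub-lqcd-lean-2-g48`, 2026-09-01.  Chapter AI (the sizes of the Robin ground state), file 22 — parents AI5, AI7, AI19 `TreePoincare`.  The list
`e_r = (r = 0 ? 0 : 1, r+1)`: the hot seat exchanges only with level `1`, which exchanges with every other level.  As a tree: parent `0 ↦ 0`, `1 ↦ 0`, `k ↦ 1`; depths `0, 1, 2`; descendants of a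
cold level at most `K` (they are cold).  AI19 gives `ρ ≥ min{t/(4K²), h/(2(K+1))}`; the cut `{k ≠ 0}` is crossed by the single pair `(0,1)`, so `ρK ≤ t/K` (AI1), i.e. `ρ ≤ t/K²`; AI2's
participation with `L = 2` gives `≥ K/12`.  READING: the star relaxes like `K/t`, the broom like `K²/t` — one bottleneck replica multiplies the transport unit by `K`, within the constant `4`;
the refresh budget is unchanged.  No definitions.

* §1 `broom_ne`, `broom_tree_facts`, `broom_descendants_le`, `broom_reachable`, `broom_connected`, `broom_rho_ge`; §2 `broom_rho_le_cut`, `broom_participation_ge`; §3 `homBroom_sharp_two_sided`.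

Literature grade (cell rule): OWN; nothing cited; no new bib keys.
-/

noncomputable section

open Finset Function Real
open Literature.Probability.MarkovChains

namespace Summit.Ventures.LatticeQCDFlow.Scaling

variable {S : Type*} [Fintype S] [DecidableEq S] {K : ℕ} {ν : S → ℝ} {M : Fin (K + 1) → S → S → ℝ} {w : Fin (K + 1) → ℝ} {t : ℝ}
  {P : (Fin (K + 1) → S) → (Fin (K + 1) → S) → ℝ}

/-! ## §1 The broom as a tree -/

omit [Fintype S] [DecidableEq S] in
/-- Distinct endpoints (`K ≥ 1`… in fact always: `r+1 ∉ {0, 1}` unless `r = 0`, where the pair is `(0,1)`). [ours] -/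
theorem broom_ne (r : Fin K) :
    ((fun r : Fin K => (((if (r : ℕ) = 0 then (0 : Fin (K + 1)) else 1), r.succ) : Fin (K + 1) × Fin (K + 1))) r).1
      ≠ ((fun r : Fin K => (((if (r : ℕ) = 0 then (0 : Fin (K + 1)) else 1), r.succ) : Fin (K + 1) × Fin (K + 1))) r).2 := by
  dsimp only
  intro h
  have hv := congrArg Fin.val h
  rw [Fin.val_succ] at hv
  split_ifs at hv with h0
  · simp at hv
  · have hK : 1 ≤ K := by have := r.2; omega
    rw [Fin.val_one'] at hv
    rw [Nat.mod_eq_of_lt (by omega)] at hv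
    omega

omit [Fintype S] [DecidableEq S] in
/-- The tree data of the broom: parent `0 ↦ 0`, `1 ↦ 0`, `k ↦ 1`; depths `0, 1, 2`; the tree pairs are the entries `k − 1`. [ours] -/
theorem broom_tree_facts (hK : 1 ≤ K) :
    ((fun k : Fin (K + 1) => (if (k : ℕ) ≤ 1 then (0 : Fin (K + 1)) else 1)) 0 = 0)
    ∧ (∀ k : Fin (K + 1), (if (k : ℕ) = 0 then 0 else if (k : ℕ) = 1 then 1 else 2) = 0 ↔ k = 0)
    ∧ (∀ k : Fin (K + 1), k ≠ 0 →
        (if (((fun k : Fin (K + 1) => (if (k : ℕ) ≤ 1 then (0 : Fin (K + 1)) else 1)) k : Fin (K + 1)) : ℕ) = 0 then 0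
         else if (((fun k : Fin (K + 1) => (if (k : ℕ) ≤ 1 then (0 : Fin (K + 1)) else 1)) k : Fin (K + 1)) : ℕ) = 1 then 1 else 2) + 1
        = (if (k : ℕ) = 0 then 0 else if (k : ℕ) = 1 then 1 else 2))
    ∧ (∀ k : Fin (K + 1), (if (k : ℕ) = 0 then 0 else if (k : ℕ) = 1 then 1 else 2) ≤ 2)
    ∧ (∀ k : Fin (K + 1), k ≠ 0 → ∃ r : Fin K,
        (((fun r : Fin K => (((if (r : ℕ) = 0 then (0 : Fin (K + 1)) else 1), r.succ) : Fin (K + 1) × Fin (K + 1))) r).1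
            = (fun k : Fin (K + 1) => (if (k : ℕ) ≤ 1 then (0 : Fin (K + 1)) else 1)) k
          ∧ ((fun r : Fin K => (((if (r : ℕ) = 0 then (0 : Fin (K + 1)) else 1), r.succ) : Fin (K + 1) × Fin (K + 1))) r).2 = k)
        ∨ (((fun r : Fin K => (((if (r : ℕ) = 0 then (0 : Fin (K + 1)) else 1), r.succ) : Fin (K + 1) × Fin (K + 1))) r).1 = k
          ∧ ((fun r : Fin K => (((if (r : ℕ) = 0 then (0 : Fin (K + 1)) else 1), r.succ) : Fin (K + 1) × Fin (K + 1))) r).2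
            = (fun k : Fin (K + 1) => (if (k : ℕ) ≤ 1 then (0 : Fin (K + 1)) else 1)) k)) := by
  have hv1 : ((1 : Fin (K + 1)) : ℕ) = 1 := by rw [Fin.val_one', Nat.mod_eq_of_lt (by omega)]
  refine ⟨by simp, fun k => ?_, fun k hk => ?_, fun k => ?_, fun k hk => ?_⟩
  · rw [Fin.ext_iff, Fin.val_zero]
    by_cases h0 : (k : ℕ) = 0
    · simp [h0]
    · rw [if_neg h0]; split_ifs <;> simp [h0]
  · have hk1 : (k : ℕ) ≠ 0 := fun h => hk (Fin.ext h)
    show (if (((if (k : ℕ) ≤ 1 then (0 : Fin (K + 1)) else 1) : Fin (K + 1)) : ℕ) = 0 then 0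
        else if (((if (k : ℕ) ≤ 1 then (0 : Fin (K + 1)) else 1) : Fin (K + 1)) : ℕ) = 1 then 1 else 2) + 1
      = (if (k : ℕ) = 0 then 0 else if (k : ℕ) = 1 then 1 else 2)
    by_cases h1 : (k : ℕ) = 1
    · rw [if_pos (show (k : ℕ) ≤ 1 by omega), Fin.val_zero, if_pos rfl, if_neg hk1, if_pos h1]
    · rw [if_neg (show ¬((k : ℕ) ≤ 1) by omega), hv1, if_neg (show ¬((1 : ℕ) = 0) by norm_num), if_pos rfl, if_neg hk1, if_neg h1]
  · split_ifs <;> omega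
  · have hk1 : (k : ℕ) ≠ 0 := fun h => hk (Fin.ext h)
    refine ⟨⟨(k : ℕ) - 1, by have := k.2; omega⟩, Or.inl ⟨?_, ?_⟩⟩
    · dsimp only
      by_cases h1 : (k : ℕ) = 1
      · rw [if_pos (by omega), if_pos (by omega)]
      · rw [if_neg (by omega), if_neg (by omega)]
    · ext; simp only [Fin.val_succ]; omega

omit [Fintype S] [DecidableEq S] in
/-- **Congestion: every cold level has at most `K` descendants-or-self** (they are all cold). [ours] -/
theorem broom_descendants_le (b : Fin (K + 1)) (_hb : b ≠ 0) (T : Finset (Fin (K + 1)))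
    (hT : ∀ k ∈ T, ∃ j, j < (if (k : ℕ) = 0 then 0 else if (k : ℕ) = 1 then 1 else 2)
      ∧ (fun k : Fin (K + 1) => (if (k : ℕ) ≤ 1 then (0 : Fin (K + 1)) else 1))^[j] k = b) :
    T.card ≤ K := by
  classical
  have hsub : T ⊆ univ.erase 0 := by
    intro k hk
    obtain ⟨j, hj, _⟩ := hT k hk
    rw [mem_erase]
    refine ⟨fun h0 => ?_, mem_univ _⟩
    rw [h0, Fin.val_zero, if_pos rfl] at hj
    omega
  calc T.card ≤ (univ.erase (0 : Fin (K + 1))).card := card_le_card hsub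
    _ = K := by rw [card_erase_of_mem (mem_univ _), card_univ, Fintype.card_fin, Nat.add_sub_cancel]

omit [Fintype S] [DecidableEq S] in
/-- **Chains of length `≤ 2`** (`0 → 1 → k`). [ours] -/
theorem broom_reachable (hK : 1 ≤ K) (k : Fin (K + 1)) :
    ∃ n : ℕ, n ≤ 2 ∧ ∃ γ : Fin (n + 1) → Fin (K + 1), γ 0 = 0 ∧ γ (Fin.last n) = k ∧
      ∀ j : Fin n, ∃ r : Fin K,
        (((fun r : Fin K => (((if (r : ℕ) = 0 then (0 : Fin (K + 1)) else 1), r.succ) : Fin (K + 1) × Fin (K + 1))) r).1 = γ j.castSucc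
          ∧ ((fun r : Fin K => (((if (r : ℕ) = 0 then (0 : Fin (K + 1)) else 1), r.succ) : Fin (K + 1) × Fin (K + 1))) r).2 = γ j.succ)
        ∨ (((fun r : Fin K => (((if (r : ℕ) = 0 then (0 : Fin (K + 1)) else 1), r.succ) : Fin (K + 1) × Fin (K + 1))) r).1 = γ j.succ
          ∧ ((fun r : Fin K => (((if (r : ℕ) = 0 then (0 : Fin (K + 1)) else 1), r.succ) : Fin (K + 1) × Fin (K + 1))) r).2 = γ j.castSucc) := by
  have hv1 : ((1 : Fin (K + 1)) : ℕ) = 1 := by rw [Fin.val_one', Nat.mod_eq_of_lt (by omega)]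
  by_cases hk0 : (k : ℕ) = 0
  · exact ⟨0, by omega, fun _ => 0, rfl, Fin.ext (by simp [hk0]), fun j => Fin.elim0 j⟩
  by_cases hk1 : (k : ℕ) = 1
  · -- the chain `0, k` through the entry `0`
    refine ⟨1, by omega, ![0, k], by simp, by simp, fun j => ?_⟩
    refine ⟨⟨0, by omega⟩, Or.inl ⟨?_, ?_⟩⟩
    · fin_cases j
      dsimp only; rw [if_pos rfl]; simp
    · fin_cases j
      ext; simp; omega
  · -- the chain `0, 1, k` through the entries `0` and `k − 1`
    refine ⟨2, le_rfl, ![0, 1, k], by simp, by simp, fun j => ?_⟩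
    fin_cases j
    · refine ⟨⟨0, by omega⟩, Or.inl ⟨?_, ?_⟩⟩
      · dsimp only; rw [if_pos rfl]; simp
      · ext; simp; rw [Nat.mod_eq_of_lt (by omega)]
    · refine ⟨⟨(k : ℕ) - 1, by have := k.2; omega⟩, Or.inl ⟨?_, ?_⟩⟩
      · have hne : (((⟨(k : ℕ) - 1, by have := k.2; omega⟩ : Fin K) : ℕ)) ≠ 0 := by show (k : ℕ) - 1 ≠ 0; omega
        dsimp only; rw [if_neg hne]; simp
      · ext; simp; omega

omit [Fintype S] [DecidableEq S] in
/-- **The broom is connected.** [ours] -/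
theorem broom_connected (hK : 1 ≤ K) (A : Finset (Fin (K + 1))) (hA : A.Nonempty) (hAu : A ≠ univ) :
    ∃ r : Fin K, (((fun r : Fin K => (((if (r : ℕ) = 0 then (0 : Fin (K + 1)) else 1), r.succ) : Fin (K + 1) × Fin (K + 1))) r).1 ∈ A
        ∧ ((fun r : Fin K => (((if (r : ℕ) = 0 then (0 : Fin (K + 1)) else 1), r.succ) : Fin (K + 1) × Fin (K + 1))) r).2 ∉ A)
      ∨ (((fun r : Fin K => (((if (r : ℕ) = 0 then (0 : Fin (K + 1)) else 1), r.succ) : Fin (K + 1) × Fin (K + 1))) r).2 ∈ A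
        ∧ ((fun r : Fin K => (((if (r : ℕ) = 0 then (0 : Fin (K + 1)) else 1), r.succ) : Fin (K + 1) × Fin (K + 1))) r).1 ∉ A) :=
  connected_of_reachable _ (broom_reachable hK) A hA hAu

omit [Fintype S] [DecidableEq S] in
/-- **THE BROOM'S RATE FLOOR: `min{t/(4K·K), h/(2(K+1))} ≤ ρ`** (AI19 with `L = 2`, `B = K`; positive solution, `K ≥ 1`, `t, h > 0`). [ours] -/
theorem broom_rho_ge (hK : 1 ≤ K) (ht : 0 < t) {h ρ : ℝ} (hh : 0 < h) {c : Fin (K + 1) → ℝ} (hc : ∀ k, 0 < c k)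
    (hvertex : ∀ k : Fin (K + 1), t / K * ∑ r : Fin K, ((if k = ((fun r : Fin K => (((if (r : ℕ) = 0 then (0 : Fin (K + 1)) else 1), r.succ) : Fin (K + 1) × Fin (K + 1))) r).1
        then c ((fun r : Fin K => (((if (r : ℕ) = 0 then (0 : Fin (K + 1)) else 1), r.succ) : Fin (K + 1) × Fin (K + 1))) r).2
          - c ((fun r : Fin K => (((if (r : ℕ) = 0 then (0 : Fin (K + 1)) else 1), r.succ) : Fin (K + 1) × Fin (K + 1))) r).1 else 0)
      + (if k = ((fun r : Fin K => (((if (r : ℕ) = 0 then (0 : Fin (K + 1)) else 1), r.succ) : Fin (K + 1) × Fin (K + 1))) r).2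
        then c ((fun r : Fin K => (((if (r : ℕ) = 0 then (0 : Fin (K + 1)) else 1), r.succ) : Fin (K + 1) × Fin (K + 1))) r).1
          - c ((fun r : Fin K => (((if (r : ℕ) = 0 then (0 : Fin (K + 1)) else 1), r.succ) : Fin (K + 1) × Fin (K + 1))) r).2 else 0))
      - (if k = 0 then h * c k else 0) = -ρ * c k) :
    min (t / (2 * (2 : ℝ) * K * K)) (h / (2 * ((K : ℝ) + 1))) ≤ ρ := by
  obtain ⟨hp0, hd0, hdp, hdL, hedge⟩ := broom_tree_facts (K := K) hK
  have h := tree_rho_ge _ (fun k : Fin (K + 1) => (if (k : ℕ) ≤ 1 then (0 : Fin (K + 1)) else 1)) (fun k : Fin (K + 1) => (if (k : ℕ) = 0 then 0 else if (k : ℕ) = 1 then 1 else 2))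
    hK ht hh hc hvertex hp0 hd0 hdp (L := 2) (B := K) (by norm_num) hK hdL hedge (fun a ha T hT => broom_descendants_le a ha T hT)
  push_cast at h
  exact h

/-! ## §2 The cut and the participation -/

omit [Fintype S] [DecidableEq S] in
/-- **THE CUT BEHIND THE BOTTLENECK: `ρ ≤ t/K²`** (`{k ≠ 0}` is left by the pair `(0,1)` only). [ours] -/
theorem broom_rho_le_cut (hK : 1 ≤ K) (ht : 0 ≤ t) {h ρ : ℝ} {c : Fin (K + 1) → ℝ} (hc : ∀ k, 0 < c k)
    (hvertex : ∀ k : Fin (K + 1), t / K * ∑ r : Fin K, ((if k = ((fun r : Fin K => (((if (r : ℕ) = 0 then (0 : Fin (K + 1)) else 1), r.succ) : Fin (K + 1) × Fin (K + 1))) r).1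
        then c ((fun r : Fin K => (((if (r : ℕ) = 0 then (0 : Fin (K + 1)) else 1), r.succ) : Fin (K + 1) × Fin (K + 1))) r).2
          - c ((fun r : Fin K => (((if (r : ℕ) = 0 then (0 : Fin (K + 1)) else 1), r.succ) : Fin (K + 1) × Fin (K + 1))) r).1 else 0)
      + (if k = ((fun r : Fin K => (((if (r : ℕ) = 0 then (0 : Fin (K + 1)) else 1), r.succ) : Fin (K + 1) × Fin (K + 1))) r).2
        then c ((fun r : Fin K => (((if (r : ℕ) = 0 then (0 : Fin (K + 1)) else 1), r.succ) : Fin (K + 1) × Fin (K + 1))) r).1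
          - c ((fun r : Fin K => (((if (r : ℕ) = 0 then (0 : Fin (K + 1)) else 1), r.succ) : Fin (K + 1) × Fin (K + 1))) r).2 else 0))
      - (if k = 0 then h * c k else 0) = -ρ * c k) :
    ρ ≤ t / (K : ℝ) ^ 2 := by
  classical
  have hKpos : (0 : ℝ) < K := Nat.cast_pos.mpr (by omega)
  have h10 : (1 : Fin (K + 1)) ≠ 0 := by
    intro h; have := congrArg Fin.val h; rw [Fin.val_one', Nat.mod_eq_of_lt (by omega)] at this; simp at this
  have hcut := groundState_rho_le_cut _ hc ht hvertex (univ.erase 0)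
  rw [if_neg (by simp), add_zero, card_erase_of_mem (mem_univ _), card_univ, Fintype.card_fin, Nat.add_sub_cancel] at hcut
  have hsub : (univ.filter fun r : Fin K =>
        (((fun r : Fin K => (((if (r : ℕ) = 0 then (0 : Fin (K + 1)) else 1), r.succ) : Fin (K + 1) × Fin (K + 1))) r).1 ∈ (univ.erase (0 : Fin (K + 1)))
          ∧ ((fun r : Fin K => (((if (r : ℕ) = 0 then (0 : Fin (K + 1)) else 1), r.succ) : Fin (K + 1) × Fin (K + 1))) r).2 ∉ (univ.erase (0 : Fin (K + 1))))
        ∨ (((fun r : Fin K => (((if (r : ℕ) = 0 then (0 : Fin (K + 1)) else 1), r.succ) : Fin (K + 1) × Fin (K + 1))) r).2 ∈ (univ.erase (0 : Fin (K + 1)))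
          ∧ ((fun r : Fin K => (((if (r : ℕ) = 0 then (0 : Fin (K + 1)) else 1), r.succ) : Fin (K + 1) × Fin (K + 1))) r).1 ∉ (univ.erase (0 : Fin (K + 1)))))
      ⊆ univ.filter (fun r : Fin K => (r : ℕ) < 1) := by
    intro r hr
    rw [mem_filter] at hr ⊢
    refine ⟨mem_univ _, ?_⟩
    rcases hr.2 with ⟨_, h2⟩ | ⟨_, h1⟩
    · exfalso; apply h2; rw [mem_erase]; exact ⟨Fin.succ_ne_zero r, mem_univ _⟩
    · rw [mem_erase, not_and_or, not_not] at h1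
      rcases h1 with h1 | h1
      · dsimp only at h1
        by_contra hge
        rw [if_neg (by omega)] at h1
        exact h10 h1
      · exact absurd (mem_univ _) h1
  have hcard1 : ((univ.filter fun r : Fin K => (r : ℕ) < 1).card : ℝ) ≤ 1 := by
    have : (univ.filter fun r : Fin K => (r : ℕ) < 1).card ≤ (range 1).card :=
      Finset.card_le_card_of_injOn (fun r => (r : ℕ)) (fun r hr => by rw [mem_coe, mem_filter] at hr; exact mem_range.mpr hr.2)
        (fun a _ b _ hab => Fin.ext hab)
    rw [card_range] at this
    exact_mod_cast this
  have hcardle := Nat.cast_le (α := ℝ).mpr (card_le_card hsub)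
  have hstep : ρ * (K : ℝ) ≤ t / K * 1 := by
    calc ρ * (K : ℝ) ≤ t / K * _ := hcut
      _ ≤ t / K * 1 := mul_le_mul_of_nonneg_left (le_trans hcardle hcard1) (div_nonneg ht hKpos.le)
  rw [le_div_iff₀ (by positivity)]
  have : ρ * (K : ℝ) ^ 2 = (ρ * K) * K := by ring
  rw [this]
  calc ρ * (K : ℝ) * K ≤ t / K * 1 * K := mul_le_mul_of_nonneg_right hstep hKpos.le
    _ = t := by field_simp

omit [Fintype S] [DecidableEq S] in
/-- **THE PARTICIPATION OF THE BROOM'S GROUND STATE: `√(K/12) ≤ Σc/√(Σc²)`** (positive solution, `ρ > 0`, `K ≥ 1`, `t, h > 0`). [ours] -/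
theorem broom_participation_ge (hK : 1 ≤ K) (ht : 0 < t) {h ρ : ℝ} (hh : 0 < h) (hρ : 0 < ρ) {c : Fin (K + 1) → ℝ} (hc : ∀ k, 0 < c k)
    (hvertex : ∀ k : Fin (K + 1), t / K * ∑ r : Fin K, ((if k = ((fun r : Fin K => (((if (r : ℕ) = 0 then (0 : Fin (K + 1)) else 1), r.succ) : Fin (K + 1) × Fin (K + 1))) r).1
        then c ((fun r : Fin K => (((if (r : ℕ) = 0 then (0 : Fin (K + 1)) else 1), r.succ) : Fin (K + 1) × Fin (K + 1))) r).2
          - c ((fun r : Fin K => (((if (r : ℕ) = 0 then (0 : Fin (K + 1)) else 1), r.succ) : Fin (K + 1) × Fin (K + 1))) r).1 else 0)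
      + (if k = ((fun r : Fin K => (((if (r : ℕ) = 0 then (0 : Fin (K + 1)) else 1), r.succ) : Fin (K + 1) × Fin (K + 1))) r).2
        then c ((fun r : Fin K => (((if (r : ℕ) = 0 then (0 : Fin (K + 1)) else 1), r.succ) : Fin (K + 1) × Fin (K + 1))) r).1
          - c ((fun r : Fin K => (((if (r : ℕ) = 0 then (0 : Fin (K + 1)) else 1), r.succ) : Fin (K + 1) × Fin (K + 1))) r).2 else 0))
      - (if k = 0 then h * c k else 0) = -ρ * c k) :
    Real.sqrt ((K : ℝ) / 12) ≤ (∑ k : Fin (K + 1), c k) / Real.sqrt (∑ k : Fin (K + 1), c k ^ 2) := by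
  have hKpos : (0 : ℝ) < K := Nat.cast_pos.mpr (by omega)
  have hpart := groundState_participation_ge _ hK ht hρ hc hvertex 2 (broom_reachable hK)
  refine le_trans (Real.sqrt_le_sqrt ?_) hpart
  have hcut := broom_rho_le_cut hK ht.le hc hvertex
  have hhot := groundState_rho_le_hot _ hc ht.le hvertex
  have hm : ((((2 : ℕ) : ℕ) : ℝ)) = 2 := by norm_num
  rw [hm]
  have hq : 0 < 1 + (2 : ℝ) * ((K : ℝ) * h / t) := by positivity
  rw [div_le_div_iff₀ (by norm_num) (mul_pos hρ hq)]
  have hexp : (K : ℝ) * (ρ * (1 + 2 * ((K : ℝ) * h / t))) = (K : ℝ) * ρ + 2 * (K : ℝ) * ρ * K * h / t := by ring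
  rw [hexp]
  have h1 : (K : ℝ) * ρ ≤ h := by nlinarith
  have h2 : 2 * (K : ℝ) * ρ * K * h / t ≤ 2 * h := by
    rw [div_le_iff₀ ht]
    have hρ' : ρ * (K : ℝ) ^ 2 ≤ t := by have := hcut; rwa [le_div_iff₀ (by positivity)] at this
    have : 2 * (K : ℝ) * ρ * K * h = 2 * (ρ * (K : ℝ) ^ 2) * h := by ring
    rw [this]
    calc 2 * (ρ * (K : ℝ) ^ 2) * h ≤ 2 * t * h := by nlinarith
      _ = 2 * h * t := by ring
  linarith

/-! ## §3 The sharp law on the broom -/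

/-- **THE HOMOGENEOUS EXCHANGE SCHEME ON THE BROOM:** `K ≥ 1`, `0 < t < 1`, `w` a probability vector with `w_0 > 0`, one positive law `ν`, exact hot sampler, idle cold kernels,
`P = t·ptGraphSwap ν^{⊗} (r ↦ (r = 0 ? 0 : 1, r+1)) 1 + (1−t)·prodKernel w M`, `h = (1−t)w_0`; then there is `ρ` with **`K²/t ≤ 1/ρ`, `(K+1)/h ≤ 1/ρ`, `min{t/(4K²), h/(2(K+1))} ≤ ρ`** and, for
every content `u`, **`((1−ρ)/ρ)·log((1−ν(u))·√(K/12)/4) ≤ t_mix(1/4) ≤ ⌈(1/ρ)·log(4h/ρ)⌉`**. [ours] -/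
theorem homBroom_sharp_two_sided (hK : 1 ≤ K) (hν : ∀ v, 0 < ν v) (hν1 : ∑ v, ν v = 1) (hM0 : ∀ u v, M 0 u v = ν v)
    (hidle : ∀ i : Fin K, ∀ u v, M i.succ u v = if v = u then 1 else 0) (hw0 : ∀ k, 0 ≤ w k) (hw00 : 0 < w 0) (hw1 : ∑ k, w k = 1) (ht0 : 0 < t) (ht1 : t < 1)
    (hP : ∀ x y, P x y = t * ptGraphSwap (fun _ : Fin (K + 1) => ν)
        (fun r : Fin K => (((if (r : ℕ) = 0 then (0 : Fin (K + 1)) else 1), r.succ) : Fin (K + 1) × Fin (K + 1))) (fun _ => Equiv.refl S) x y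
      + (1 - t) * prodKernel w M x y) (u : S) :
    ∃ ρ : ℝ, 0 < ρ ∧ (K : ℝ) ^ 2 / t ≤ 1 / ρ ∧ ((K : ℝ) + 1) / ((1 - t) * w 0) ≤ 1 / ρ ∧
      min (t / (2 * (2 : ℝ) * K * K)) ((1 - t) * w 0 / (2 * ((K : ℝ) + 1))) ≤ ρ ∧
      (1 - ρ) / ρ * Real.log ((1 - ν u) * Real.sqrt ((K : ℝ) / 12) / 4) ≤ (mixingTime P (tensorFun (fun _ : Fin (K + 1) => ν)) (1 / 4) : ℝ) ∧
      mixingTime P (tensorFun (fun _ : Fin (K + 1) => ν)) (1 / 4) ≤ ⌈1 / ρ * Real.log (4 * ((1 - t) * w 0) / ρ)⌉₊ := by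
  have hKpos : (0 : ℝ) < K := Nat.cast_pos.mpr (by omega)
  have hhh : 0 < (1 - t) * w 0 := mul_pos (by linarith) hw00
  have he := broom_ne (K := K)
  obtain ⟨c, ρ, hcpos, hcS, hρ0, hρle, hvertex⟩ := graph_groundState_exists
    (fun r : Fin K => (((if (r : ℕ) = 0 then (0 : Fin (K + 1)) else 1), r.succ) : Fin (K + 1) × Fin (K + 1))) (t := t) (h := (1 - t) * w 0) hK ht0 hhh (broom_connected hK)
  have htwo := graphScheme_sharp_two_sided_mode
    (fun r : Fin K => (((if (r : ℕ) = 0 then (0 : Fin (K + 1)) else 1), r.succ) : Fin (K + 1) × Fin (K + 1))) hK he hν hν1 hM0 hidle hw0 hw00 hw1 ht0 ht1 hP hρ0 hcpos hvertex u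
  have hcut := broom_rho_le_cut hK ht0.le hcpos hvertex
  have hfloorρ := broom_rho_ge hK ht0 hhh hcpos hvertex
  have hpart := broom_participation_ge hK ht0 hhh hρ0 hcpos hvertex
  have hρ1 : ρ < 1 := by
    have hw01 : w 0 ≤ 1 := by
      calc w 0 ≤ ∑ k, w k := Finset.single_le_sum (fun k _ => hw0 k) (mem_univ 0)
        _ = 1 := hw1
    have : (1 - t) * w 0 / ((K : ℝ) + 1) ≤ (1 - t) * w 0 := div_le_self hhh.le (by linarith)
    nlinarith
  refine ⟨ρ, hρ0, ?_, ?_, hfloorρ, le_trans ?_ htwo.1, htwo.2⟩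
  · rw [div_le_div_iff₀ ht0 hρ0, one_mul]
    have := hcut
    rw [le_div_iff₀ (by positivity)] at this
    linarith
  · rw [div_le_div_iff₀ hhh hρ0, one_mul]
    calc ((K : ℝ) + 1) * ρ ≤ ((K : ℝ) + 1) * ((1 - t) * w 0 / ((K : ℝ) + 1)) := mul_le_mul_of_nonneg_left hρle (by linarith)
      _ = (1 - t) * w 0 := by field_simp
  · have hνu : ν u ≤ 1 := by
      calc ν u ≤ ∑ v, ν v := Finset.single_le_sum (fun v _ => (hν v).le) (mem_univ u)
        _ = 1 := hν1
    have hcoef : 0 ≤ (1 - ρ) / ρ := div_nonneg (by linarith) hρ0.le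
    rcases eq_or_lt_of_le hνu with heq | hlt
    · rw [heq]; simp
    · have hA : 0 < (1 - ν u) * Real.sqrt ((K : ℝ) / 12) / 4 := by
        have : 0 < Real.sqrt ((K : ℝ) / 12) := Real.sqrt_pos.mpr (by positivity)
        have : 0 < 1 - ν u := by linarith
        positivity
      refine floorLog_mono hcoef hA ?_
      have h4 : (1 - ν u) * Real.sqrt ((K : ℝ) / 12) / 4 = (1 - ν u) / 4 * Real.sqrt ((K : ℝ) / 12) := by ring
      have h5 : (1 - ν u) * (∑ k : Fin (K + 1), c k) / (4 * Real.sqrt (∑ k : Fin (K + 1), c k ^ 2))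
          = (1 - ν u) / 4 * ((∑ k : Fin (K + 1), c k) / Real.sqrt (∑ k : Fin (K + 1), c k ^ 2)) := by ring
      rw [h4, h5]
      exact mul_le_mul_of_nonneg_left hpart (by linarith)

end Summit.Ventures.LatticeQCDFlow.Scaling

end
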